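/-
VALUE = DECIDABLE VERDICT at p = 13 (one compiled evaluation of the certificate of
`ReflectionClassCertificateBFS`), NOT summit progress (cell b2b-lgcu-borel, gen 23); the crux item
stmt-MatrixMultiplication-14079 is untouched.
-/
import Mathlib
import Summits.MatrixMultiplication.MatrixMultiplication.Theorems.SubgroupIdentityDesigns.Negative.ReflectionClassCertificateBFS

/-!
# No member contains the non-square reflections of `𝔽₁₃^m`: the twisted class `≅ PGL₂(𝔽₁₃)`

VALUE = DECIDABLE VERDICT (`p = 13`, every `ε`, every `m ≥ 3`, no TPP, no budget), NOT summit
progress; the crux item stmt-MatrixMultiplication-14079 is untouched and remains open.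

THE CLASS.  `K = ⟨R_b : b·b a non-square⟩ = {g ∈ O₃(𝔽₁₃) : det g = 1 ⇔ θ(g) a square}` (`θ` the
spinor norm): the index-`2` subgroup of `O₃(𝔽₁₃)` of order `2184` isomorphic to `PGL₂(𝔽₁₃)` that
contains neither `−1` nor a square reflection, generated by the `78` non-square reflections of
`(𝔽₁₃³, x² + y² + z²)`: the `p = 13`
instance of the `m = 3` reflection class of sign `−χ(−1)` (the non-square class, `13 ≡ 1 (mod 4)`;
`NonsquareReflections` needs `p ≡ 3 (mod 4)`, `NonsquareReflectionsFour` needs `m ≥ 4`), the first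
instance out of reach of the word-closure certificates (`KS`, `KSF`).

THE VERDICT.  `cert_thirteen : certG (KSG (gens ws) 16) (gens ws) false ws 2 X₀ = true`
(`native_decide`; `X₀ = (0, 1, 1)` on the sphere `Q = 2`; `ws` = the three generator words
`r_a r_b`, `r_b r_a`, `r_c` below, breadth-first depth `16`): the closure has the `2184` elements of
`K`, is closed, orthogonal with `det = ±1`, and every twisted-stabiliser orbit sum of the weight
`w(v) = χ(Q(v + X₀)) − χ(Q(v − X₀)) + 13([v = X₀] − [v = −X₀])` (`χ(−1) = 1`: no linear term)
on the sphere vanishes while `w(X₀) = 12`.  By `ReflectionClassCertificateBFS.no_design_nsq_memᵢ_of_certG`: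

THEOREMS `no_design_nsq_mem₁/₂/₃_thirteen`: NO MEMBER OF A TRIPLE IN `GL_m(𝔽₁₃)`, `m ≥ 3`, CARRYING
A LEVEL-ONE IDENTITY DESIGN CONTAINS ALL NON-SQUARE REFLECTIONS OF `𝔽₁₃^m`.  With the files
for `p ≤ 11`: for `p ∈ {3, 5, 7, 11, 13}` no member contains all reflections of either square class
of `𝔽_p^m`, `m ≥ 3`; the open instances are `m = 3`, `p ≥ 17`, class of sign `−χ(−1)`.

HONEST SCOPE.  Configuration exclusion at `p = 13`; no `(p,m,ε)` cell is emptied.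
-/

set_option linter.dupNamespace false

open scoped BigOperators Matrix

namespace Summit.MatrixMultiplication.MatrixMultiplication.Theorems.SubgroupIdentityDesigns.Negative
namespace NonsquareReflectionsThirteen

open Summit.MatrixMultiplication.MatrixMultiplication.Theorems.LieRankDesigns.Negative (GLm Mat)
open NonsquareReflections (refl)
open ReflectionClassCertificate (V)
open ReflectionClassCertificateBFS (gens KSG certG no_design_nsq_mem₁_of_certG
  no_design_nsq_mem₂_of_certG no_design_nsq_mem₃_of_certG)

/-- `13` is prime (instance for the level vocabulary at `p = 13`). -/
instance fact_prime_thirteen : Fact (Nat.Prime 13) := ⟨by norm_num⟩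

/-- The base point `X₀ = (0, 1, 1)` of the sphere `Q = 2` in `𝔽₁₃³`. -/
def X₀ : V 13 := ![0, 1, 1]

/-- The generator words: `r_a r_b`, its inverse `r_b r_a`, and one reflection `r_c` (all three
vectors have `b·b` a non-square mod `13`). -/
def ws : List (List (V 13)) :=
  [[![1, 4, 4], ![1, 3, 7]], [![1, 3, 7], ![1, 4, 4]], [![1, 12, 9]]]

/-- **THE CERTIFICATE OF THE NON-SQUARE CLASS AT `p = 13`, EVALUATED.** -/
theorem cert_thirteen : certG (KSG (gens ws) 16) (gens ws) false ws 2 X₀ = true := by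
  native_decide

variable {m : ℕ} {H₁ H₂ H₃ : Subgroup (GLm 13 m)}

/-- **NO MEMBER OF A TRIPLE IN `GL_m(𝔽₁₃)`, `m ≥ 3`, WITH A LEVEL-ONE IDENTITY DESIGN CONTAINS ALL
NON-SQUARE REFLECTIONS OF `𝔽₁₃^m`**: member `1`. -/
theorem no_design_nsq_mem₁_thirteen (hm : 3 ≤ m)
    (h₁ : ∀ b : Fin m → ZMod 13, ¬ IsSquare (b ⬝ᵥ b) → refl b ∈ H₁) :
    ¬ ∃ c : Mat 13 m → ℂ, (∀ M, 1 < M.rank → c M = 0) ∧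
      (∑ M, c M * ZMod.stdAddChar (Matrix.trace (M * ((1 : GLm 13 m) : Mat 13 m)))) = 1 ∧
      ∀ a ∈ H₁, ∀ b ∈ H₂, ∀ g ∈ H₃, a * b * g ≠ 1 →
        (∑ M, c M * ZMod.stdAddChar (Matrix.trace (M * ((a * b * g : GLm 13 m) : Mat 13 m)))) = 0 :=
  no_design_nsq_mem₁_of_certG cert_thirteen hm h₁

/-- Member `2`. -/
theorem no_design_nsq_mem₂_thirteen (hm : 3 ≤ m)
    (h₂ : ∀ b : Fin m → ZMod 13, ¬ IsSquare (b ⬝ᵥ b) → refl b ∈ H₂) :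
    ¬ ∃ c : Mat 13 m → ℂ, (∀ M, 1 < M.rank → c M = 0) ∧
      (∑ M, c M * ZMod.stdAddChar (Matrix.trace (M * ((1 : GLm 13 m) : Mat 13 m)))) = 1 ∧
      ∀ a ∈ H₁, ∀ b ∈ H₂, ∀ g ∈ H₃, a * b * g ≠ 1 →
        (∑ M, c M * ZMod.stdAddChar (Matrix.trace (M * ((a * b * g : GLm 13 m) : Mat 13 m)))) = 0 :=
  no_design_nsq_mem₂_of_certG cert_thirteen hm h₂

/-- Member `3`. -/
theorem no_design_nsq_mem₃_thirteen (hm : 3 ≤ m)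
    (h₃ : ∀ b : Fin m → ZMod 13, ¬ IsSquare (b ⬝ᵥ b) → refl b ∈ H₃) :
    ¬ ∃ c : Mat 13 m → ℂ, (∀ M, 1 < M.rank → c M = 0) ∧
      (∑ M, c M * ZMod.stdAddChar (Matrix.trace (M * ((1 : GLm 13 m) : Mat 13 m)))) = 1 ∧
      ∀ a ∈ H₁, ∀ b ∈ H₂, ∀ g ∈ H₃, a * b * g ≠ 1 →
        (∑ M, c M * ZMod.stdAddChar (Matrix.trace (M * ((a * b * g : GLm 13 m) : Mat 13 m)))) = 0 :=
  no_design_nsq_mem₃_of_certG cert_thirteen hm h₃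

end NonsquareReflectionsThirteen
end Summit.MatrixMultiplication.MatrixMultiplication.Theorems.SubgroupIdentityDesigns.Negative
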